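import Literature.Claims.NS.Aksman2026
import Mathlib.Analysis.Calculus.MeanValue
import HarnessLib

/-!
# C175 `Aksman2026` — records-grade kernel object: `¬ Step_12`
# (the gradient of one vorton is unbounded at its pole)

`Literature.Claims.NS.Aksman2026.Step_12` types display (12) p.6 l.4–11 «With the spacing floor ρmin,
intensity cap Γmax, and fixed N, the velocity gradient is uniformly bounded:
‖∇u‖_{L∞} ≤ C0 N Γmax/σ²min ≡ Kmax < ∞» for the represented velocity `u = Σ_α v^(α)` of (5)/(2):
ONE `C₀ > 0` such that for all `N`, positions `R`, intensities `Γ` with `|Γ α| ≤ Γmax` and spacing `ρ`,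
`‖D(superpos R Γ)(x)‖ ≤ C₀ N Γmax / ρ²` at EVERY point `x`. CONSUMED binder 5 of `claim_of_steps`.

It is false already for TWO unit vortons at distance `10` (so the print's `σ_min` has a referent;
`Γmax = 1`): the Biot–Savart field (2) of the unit vorton `γ = e₂` (third basis vector) at the origin is
`v₀(x) = (4π|x|³)⁻¹ (−x₁, x₀, 0)`; on the ray `t·e₀`, `t > 0`, it equals `(4πt²)⁻¹ e₁` exactly; the far
vorton's field `v₁` is `C¹` near the origin with some gradient bound `L` on the unit ball; the mean-value
inequality (Mathlib `Convex.norm_image_sub_le_of_norm_fderiv_le`) for `v₀ + v₁` (claimed bound `C₀·2/10²`)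
on the half-space `{x₀ > 0}` and for `v₁` on the unit ball gives `3/(16πt²) = ‖v₀(2t e₀) − v₀(t e₀)‖ ≤
(C₀/50 + L) t` for `0 < t ≤ ½` — false for small `t` (the gradient of (2) is `O(|x − r|⁻³)` at each pole,
whatever the spacing; the print's «flooring the core (σ = a)» p.6 l.24 is not part of the represented
field (2)/(5) that (12) is asserted for).

Main results (namespace `Summit.NavierStokesRegularity.NavierStokesRegularity.Theorems.Aksman2026Grad`, new):
`cross_single_two`, `contDiff_cross_right`, `contDiffAt_vortonVel`, `differentiableAt_vortonVel`,
`exists_bound_fderiv_vortonVel`, `vortonVel_ray`, `superpos_two`, `not_Step_12`.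

WHAT THIS IS NOT: not a claim about NS regularity or blow-up; not a claim about any author beyond the
typed locator [cite: Aksman2026, (12) p.6 l.2–11]. ADJUDICATED #160 is located at `Step_repr_exact`
(binder 1); this object is a records-grade «second located failure» candidate, no head / class change.
-/

noncomputable section

set_option linter.dupNamespace false

open Set Function Filter MeasureTheory Metric
open scoped Topology ContDiff Matrix

namespace Summit.NavierStokesRegularity.NavierStokesRegularity.Theorems.Aksman2026Grad

open Literature.Claims.NS.Aksman2026

/-! ## The unit vorton `γ = e₂` at the origin -/

/-- `e₂ × b = (−b₁, b₀, 0)` for the skeleton's `cross` (Mathlib `crossProduct` transported to `E3`). [folklore] -/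
theorem cross_single_two (b : E3) :
    cross (EuclideanSpace.single 2 (1:ℝ)) b = (EuclideanSpace.equiv (Fin 3) ℝ).symm ![-(b 1), b 0, 0] := by
  ext i
  fin_cases i <;> simp [cross, cross_apply]

/-- `b ↦ a × b` is smooth (it is linear: `crossProduct a` transported along the continuous linear
equivalence `EuclideanSpace.equiv`). [folklore] -/
theorem contDiff_cross_right (a : E3) : ContDiff ℝ 1 fun b : E3 => cross a b := by
  have h1 : ContDiff ℝ 1 fun y : Fin 3 → ℝ => crossProduct (EuclideanSpace.equiv (Fin 3) ℝ a) y :=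
    (LinearMap.toContinuousLinearMap (crossProduct (EuclideanSpace.equiv (Fin 3) ℝ a))).contDiff
  exact (EuclideanSpace.equiv (Fin 3) ℝ).symm.contDiff.comp
    (h1.comp (EuclideanSpace.equiv (Fin 3) ℝ).contDiff)

/-- The vorton field (2) is `C¹` away from its pole. [folklore] -/
theorem contDiffAt_vortonVel (r γ : E3) {x : E3} (hx : x ≠ r) :
    ContDiffAt ℝ 1 (vortonVel r γ) x := by
  have hx' : x - r ≠ 0 := sub_ne_zero.2 hx
  have hn : ContDiffAt ℝ 1 (fun y : E3 => ‖y - r‖) x :=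
    (contDiffAt_id.sub contDiffAt_const).norm ℝ hx'
  have hden : ContDiffAt ℝ 1 (fun y : E3 => 4 * Real.pi * ‖y - r‖ ^ 3) x :=
    contDiffAt_const.mul (hn.pow 3)
  have hne : 4 * Real.pi * ‖x - r‖ ^ 3 ≠ 0 := by
    have : 0 < ‖x - r‖ := norm_pos_iff.2 hx'
    positivity
  have hscal : ContDiffAt ℝ 1 (fun y : E3 => (4 * Real.pi * ‖y - r‖ ^ 3)⁻¹) x := hden.inv hne
  have hvec : ContDiffAt ℝ 1 (fun y : E3 => cross γ (y - r)) x :=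
    (contDiff_cross_right γ).contDiffAt.comp x (contDiffAt_id.sub contDiffAt_const)
  have hfun : vortonVel r γ = fun y : E3 => (4 * Real.pi * ‖y - r‖ ^ 3)⁻¹ • cross γ (y - r) := by
    funext y
    simp only [vortonVel, one_div]
  rw [hfun]
  exact hscal.smul hvec

/-- The vorton field (2) is differentiable away from its pole. [folklore] -/
theorem differentiableAt_vortonVel (r γ : E3) {x : E3} (hx : x ≠ r) :
    DifferentiableAt ℝ (vortonVel r γ) x :=
  (contDiffAt_vortonVel r γ hx).differentiableAt one_ne_zero

/-- **The gradient of a vorton field is bounded on a compact set away from its pole** (here: on the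
closed unit ball, for a pole at distance `> 2` from the origin). [folklore] -/
theorem exists_bound_fderiv_vortonVel {r : E3} (hr : 2 < ‖r‖) (γ : E3) :
    ∃ L : ℝ, ∀ x ∈ Metric.closedBall (0 : E3) 1, ‖fderiv ℝ (vortonVel r γ) x‖ ≤ L := by
  have hne : ∀ x ∈ Metric.ball (0 : E3) 2, x ≠ r := fun x hx h => by
    rw [h, Metric.mem_ball, dist_zero_right] at hx
    linarith
  have hcd : ContDiffOn ℝ 1 (vortonVel r γ) (Metric.ball (0 : E3) 2) := fun x hx =>
    (contDiffAt_vortonVel r γ (hne x hx)).contDiffWithinAt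
  have hcont : ContinuousOn (fderiv ℝ (vortonVel r γ)) (Metric.ball (0 : E3) 2) :=
    hcd.continuousOn_fderiv_of_isOpen Metric.isOpen_ball le_rfl
  obtain ⟨L, hL⟩ := (isCompact_closedBall (0 : E3) 1).exists_bound_of_continuousOn
    (hcont.mono (Metric.closedBall_subset_ball (by norm_num)))
  exact ⟨L, hL⟩

/-- **The field on the ray**: for `t > 0`, `v(t e₀) = (4πt²)⁻¹ e₁` for the unit vorton `γ = e₂` at the
origin (`‖t e₀‖ = t`, `e₂ × (t e₀) = t e₁`). [cite: Aksman2026, (2) p.2 l.40–49] -/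
theorem vortonVel_ray {t : ℝ} (ht : 0 < t) :
    vortonVel 0 (EuclideanSpace.single 2 (1:ℝ)) (t • EuclideanSpace.single 0 (1:ℝ)) =
      (1 / (4 * Real.pi * t ^ 2)) • EuclideanSpace.single 1 (1:ℝ) := by
  have hns : ‖EuclideanSpace.single (0 : Fin 3) (1:ℝ)‖ = 1 := by simp
  have hnorm : ‖t • EuclideanSpace.single (0 : Fin 3) (1:ℝ) - 0‖ = t := by
    rw [sub_zero, norm_smul, hns, Real.norm_eq_abs, abs_of_pos ht, mul_one]
  have hcross : cross (EuclideanSpace.single 2 (1:ℝ)) (t • EuclideanSpace.single 0 (1:ℝ) - 0) =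
      t • EuclideanSpace.single 1 (1:ℝ) := by
    rw [sub_zero]
    ext i
    fin_cases i <;> simp [cross, cross_apply]
  rw [vortonVel, hnorm, hcross, smul_smul]
  congr 1
  field_simp

/-- Two vortons: the superposition (5) with `N = 2` is the sum of the two vorton fields. [folklore] -/
theorem superpos_two (r₀ r₁ γ : E3) :
    superpos (fun α : Fin 2 => if α = 0 then r₀ else r₁) (fun _ : Fin 2 => γ) =
      fun x => vortonVel r₀ γ x + vortonVel r₁ γ x := by
  funext x
  simp [superpos, Fin.sum_univ_two]

/-! ## The refutation -/

/-- **`Step_12` is false as typed** ((12) p.6 l.4–11), on a genuine TWO-vorton configuration (so that the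
print's `σ_min` = inter-vorton spacing has a referent): unit vortons `γ = e₂` at the origin and at `−10 e₀`,
`ρ = 10`, `Γmax = 1`; the claimed bound reads `‖D(v₀ + v₁)(x)‖ ≤ C₀·2/100` at every `x`. The far vorton
`v₁` is `C¹` on the ball `B(0,2)`, so `‖Dv₁‖ ≤ L` on the closed unit ball; both `v₀ + v₁` (on the convex
half-space `{x₀ > 0}`, which misses both poles) and `v₁` (on the unit ball) obey the mean-value inequality
along the ray `t e₀`, `0 < t ≤ ½`, whence `3/(16πt²) = ‖v₀(2t e₀) − v₀(t e₀)‖ ≤ (C₀/50 + L)·t` — absurd for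
small `t` (the gradient of (2) is `O(|x − r|⁻³)` at each pole, whatever the spacing).
[cite: Aksman2026, (12) p.6 l.2–11; (2) p.2 l.40–49] -/
theorem not_Step_12 : ¬ Literature.Claims.NS.Aksman2026.Step_12 := by
  rintro ⟨C₀, hC₀, h⟩
  -- two unit vortons: at the origin and at `-10 e₀`
  have hns0 : ‖EuclideanSpace.single (0 : Fin 3) (1:ℝ)‖ = 1 := by simp
  have hns1 : ‖EuclideanSpace.single (1 : Fin 3) (1:ℝ)‖ = 1 := by simp
  have hr1 : ‖(-(10:ℝ)) • EuclideanSpace.single (0 : Fin 3) (1:ℝ)‖ = 10 := by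
    rw [norm_smul, hns0, mul_one, Real.norm_eq_abs]
    norm_num
  have hsp : SpacedBy (10:ℝ)
      (fun α : Fin 2 => if α = 0 then (0 : E3) else (-(10:ℝ)) • EuclideanSpace.single 0 (1:ℝ)) := by
    intro α β hαβ
    fin_cases α <;> fin_cases β
    · exact absurd rfl hαβ
    · simp only [Fin.zero_eta, Fin.isValue, ↓reduceIte, Fin.mk_one, one_ne_zero, zero_sub, norm_neg]
      rw [hr1]
    · simp only [Fin.mk_one, Fin.isValue, one_ne_zero, ↓reduceIte, Fin.zero_eta, sub_zero]
      rw [hr1]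
    · exact absurd rfl hαβ
  have hΓ : ∀ α : Fin 2, ‖(fun _ : Fin 2 => EuclideanSpace.single (2 : Fin 3) (1:ℝ)) α‖ ≤ 1 := fun α => by
    simp
  have hb := h 2 _ (fun _ => EuclideanSpace.single 2 (1:ℝ)) 10 1 (by norm_num) hsp hΓ
  rw [superpos_two] at hb
  set v₀ : E3 → E3 := vortonVel 0 (EuclideanSpace.single 2 (1:ℝ)) with hv₀
  set v₁ : E3 → E3 := vortonVel ((-(10:ℝ)) • EuclideanSpace.single 0 (1:ℝ)) (EuclideanSpace.single 2 (1:ℝ))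
    with hv₁
  have hbound : ∀ x : E3, ‖fderiv ℝ (fun y => v₀ y + v₁ y) x‖ ≤ C₀ * 2 / 100 := fun x => by
    have := hb x
    norm_num at this ⊢
    linarith
  -- the far vorton has a bounded gradient on the unit ball
  obtain ⟨L, hL⟩ := exists_bound_fderiv_vortonVel (r := (-(10:ℝ)) • EuclideanSpace.single (0 : Fin 3) (1:ℝ))
    (by rw [hr1]; norm_num) (EuclideanSpace.single 2 (1:ℝ))
  -- mean-value inequality for `v₀ + v₁` on the half-space `{x₀ > 0}` (which misses both poles)
  set S : Set E3 := {x | 0 < x 0} with hS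
  have hconv : Convex ℝ S := by
    have hlin : IsLinearMap ℝ fun x : E3 => x 0 :=
      ((EuclideanSpace.proj (0 : Fin 3) : E3 →L[ℝ] ℝ) : E3 →ₗ[ℝ] ℝ).isLinear
    simpa [hS] using convex_halfSpace_gt hlin (0:ℝ)
  have hS0 : ∀ x ∈ S, x ≠ 0 := fun x hx h0 => by
    rw [h0] at hx
    simp [hS] at hx
  have hS1 : ∀ x ∈ S, x ≠ (-(10:ℝ)) • EuclideanSpace.single (0 : Fin 3) (1:ℝ) := fun x hx h1 => by
    rw [h1] at hx
    simp [hS] at hx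
    linarith
  have hdiff : ∀ x ∈ S, DifferentiableAt ℝ (fun y => v₀ y + v₁ y) x := fun x hx =>
    (differentiableAt_vortonVel _ _ (hS0 x hx)).add (differentiableAt_vortonVel _ _ (hS1 x hx))
  have hmemS : ∀ {t : ℝ}, 0 < t → t • EuclideanSpace.single (0 : Fin 3) (1:ℝ) ∈ S := fun ht => by
    simp [hS, ht]
  -- mean-value inequality for `v₁` on the closed unit ball
  have hdiff1 : ∀ x ∈ Metric.closedBall (0 : E3) 1, DifferentiableAt ℝ v₁ x := fun x hx => by
    refine differentiableAt_vortonVel _ _ fun h1 => ?_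
    rw [h1, Metric.mem_closedBall, dist_zero_right, hr1] at hx
    norm_num at hx
  have hmemB : ∀ {t : ℝ}, 0 < t → t ≤ 1 → t • EuclideanSpace.single (0 : Fin 3) (1:ℝ) ∈ Metric.closedBall (0 : E3) 1 :=
    fun ht ht1 => by
    rw [Metric.mem_closedBall, dist_zero_right, norm_smul, hns0, mul_one, Real.norm_eq_abs, abs_of_pos ht]
    exact ht1
  -- choose `t`
  set K : ℝ := C₀ * 2 / 100 + L with hK
  obtain ⟨t, ht, ht2, htK⟩ : ∃ t : ℝ, 0 < t ∧ t ≤ 1 / 2 ∧ K * t < 3 / (16 * Real.pi) := by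
    refine ⟨min (1 / 2) (3 / (32 * Real.pi * (|K| + 1))), lt_min (by norm_num) (by positivity),
      min_le_left _ _, ?_⟩
    have hle : min (1 / 2) (3 / (32 * Real.pi * (|K| + 1))) ≤ 3 / (32 * Real.pi * (|K| + 1)) :=
      min_le_right _ _
    have hpos : 0 < min (1 / 2) (3 / (32 * Real.pi * (|K| + 1))) := lt_min (by norm_num) (by positivity)
    have h1 : K * min (1 / 2) (3 / (32 * Real.pi * (|K| + 1))) ≤ |K| * (3 / (32 * Real.pi * (|K| + 1))) :=
      (mul_le_mul_of_nonneg_right (le_abs_self K) hpos.le).trans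
        (mul_le_mul_of_nonneg_left hle (abs_nonneg K))
    have h2 : |K| * (3 / (32 * Real.pi * (|K| + 1))) < 3 / (16 * Real.pi) := by
      rw [mul_div_assoc', div_lt_div_iff₀ (by positivity) (by positivity)]
      nlinarith [Real.pi_pos, abs_nonneg K]
    exact h1.trans_lt h2
  have h2t : (2 * t) • EuclideanSpace.single (0 : Fin 3) (1:ℝ) - t • EuclideanSpace.single 0 (1:ℝ) =
      t • EuclideanSpace.single 0 (1:ℝ) := by
    rw [← sub_smul]; ring_nf
  have hdist : ‖(2 * t) • EuclideanSpace.single (0 : Fin 3) (1:ℝ) - t • EuclideanSpace.single 0 (1:ℝ)‖ = t := by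
    rw [h2t, norm_smul, hns0, mul_one, Real.norm_eq_abs, abs_of_pos ht]
  have hMV := hconv.norm_image_sub_le_of_norm_fderiv_le hdiff (fun x _ => hbound x) (hmemS ht)
    (hmemS (by positivity : 0 < 2 * t))
  have hMV1 := (convex_closedBall (0 : E3) 1).norm_image_sub_le_of_norm_fderiv_le hdiff1 hL
    (hmemB ht (by linarith)) (hmemB (by positivity : 0 < 2 * t) (by linarith))
  rw [hdist] at hMV hMV1
  -- isolate the near vorton: `‖v₀(2t e₀) − v₀(t e₀)‖ ≤ K t`
  have hnear : ‖v₀ ((2 * t) • EuclideanSpace.single 0 (1:ℝ)) - v₀ (t • EuclideanSpace.single 0 (1:ℝ))‖ ≤ K * t := by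
    have hsplit : v₀ ((2 * t) • EuclideanSpace.single 0 (1:ℝ)) - v₀ (t • EuclideanSpace.single 0 (1:ℝ)) =
        (v₀ ((2 * t) • EuclideanSpace.single 0 (1:ℝ)) + v₁ ((2 * t) • EuclideanSpace.single 0 (1:ℝ)) -
            (v₀ (t • EuclideanSpace.single 0 (1:ℝ)) + v₁ (t • EuclideanSpace.single 0 (1:ℝ)))) -
          (v₁ ((2 * t) • EuclideanSpace.single 0 (1:ℝ)) - v₁ (t • EuclideanSpace.single 0 (1:ℝ))) := by
      abel
    rw [hsplit, hK]
    calc _ ≤ ‖v₀ ((2 * t) • EuclideanSpace.single 0 (1:ℝ)) + v₁ ((2 * t) • EuclideanSpace.single 0 (1:ℝ)) -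
              (v₀ (t • EuclideanSpace.single 0 (1:ℝ)) + v₁ (t • EuclideanSpace.single 0 (1:ℝ)))‖ +
            ‖v₁ ((2 * t) • EuclideanSpace.single 0 (1:ℝ)) - v₁ (t • EuclideanSpace.single 0 (1:ℝ))‖ :=
          norm_sub_le _ _
      _ ≤ C₀ * 2 / 100 * t + L * t := add_le_add hMV hMV1
      _ = (C₀ * 2 / 100 + L) * t := by ring
  -- evaluate the near vorton on the ray
  rw [hv₀, vortonVel_ray ht, vortonVel_ray (by positivity : 0 < 2 * t), ← sub_smul, norm_smul,
    hns1, mul_one, Real.norm_eq_abs] at hnear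
  have hval : |1 / (4 * Real.pi * (2 * t) ^ 2) - 1 / (4 * Real.pi * t ^ 2)| = 3 / (16 * Real.pi * t ^ 2) := by
    have hπ : 0 < Real.pi := Real.pi_pos
    rw [abs_of_nonpos (by
      rw [sub_nonpos]
      apply div_le_div_of_nonneg_left zero_le_one (by positivity)
      nlinarith [sq_nonneg t])]
    field_simp
    ring
  rw [hval] at hnear
  -- `3/(16π t²) ≤ K t` with `t ≤ 1/2` contradicts `K t < 3/(16π)`
  have ht2' : 0 < t ^ 2 := by positivity
  have h3 : 3 / (16 * Real.pi) ≤ K * t * t ^ 2 := by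
    have := mul_le_mul_of_nonneg_right hnear ht2'.le
    rwa [div_mul_eq_mul_div, mul_comm (3 : ℝ) (t ^ 2), mul_div_assoc,
      show t ^ 2 * (3 / (16 * Real.pi * t ^ 2)) = 3 / (16 * Real.pi) by field_simp] at this
  have hpos3 : 0 < 3 / (16 * Real.pi) := by positivity
  rcases le_or_gt K 0 with hKs | hKs
  · have : K * t * t ^ 2 ≤ 0 :=
      mul_nonpos_of_nonpos_of_nonneg (mul_nonpos_of_nonpos_of_nonneg hKs ht.le) ht2'.le
    linarith
  · have h4 : K * t * t ^ 2 ≤ K * t := by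
      have : t ^ 2 ≤ 1 := by nlinarith
      calc K * t * t ^ 2 ≤ K * t * 1 := mul_le_mul_of_nonneg_left this (by positivity)
        _ = K * t := mul_one _
    linarith

end Summit.NavierStokesRegularity.NavierStokesRegularity.Theorems.Aksman2026Grad

end
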